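import Literature.NumberTheory.Automorphic.UnitaryGroupLocalFactors
import Literature.NumberTheory.Automorphic.UnitaryGroupArchimedean
import HarnessLib

/-!
# The archimedean local factors `U(J)(F_v)`, `v ∣ ∞`, and `U(J)(E ⊗ ℝ) ≅ ∏_{v ∣ ∞} U(J)(F_v)`

Registry: pub-hodgecm MODEL-CONSTRUCTION sub-cell, MODEL-DAG node **U2** (vi). Companion of
`UnitaryGroupArchimedean` (U2-iii: the archimedean group `U(J)(E ⊗ ℝ)` as ONE closed subgroup
`UnitaryGroup.arch F E c N J ≤ GL_N(E ⊗_ℚ ℝ)`), supplying the archimedean groups PLACE BY PLACE.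

Setting: `E/F` number fields, `c ∈ Aut(E/F)`, `J ∈ M_N(E)`. At a COMPLEX place `w` of `E` FIXED by `c ≠ 1`
(then `c ⊗ 1` acts on the `w`-coordinate of `E ⊗ ℝ` by complex conjugation — tree `conjCoord_eq_conj`) the
local archimedean group is the genuine unitary group of the hermitian matrix `σ_w(J)`:

* `UnitaryGroup.archLocal E N J w ≤ GL_N(ℂ)` = `U(σ_w J)(ℂ) = {g ∣ ḡᵀ σ_w(J) g = σ_w(J)}` (a real Lie group
  `U(p,q)` when `σ_w(J)` is hermitian of signature `(p,q)`); closed; **compact when `σ_w(J)` is definite**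
  (`isCompact_archLocal_of_posDef`, from U2-iii's entry bound `Matrix.exists_norm_entry_le_of_posDef`);
* `UnitaryGroup.archAt … w : U(J)(E ⊗ ℝ) →* U(σ_w J)(ℂ)`, the `w`-component (continuous);
* the rational points: `rationalToArch : U(J)(F) →* U(J)(E ⊗ ℝ)` (diagonal, via Mathlib's `mixedEmbedding`;
  `conjMixed_mixedEmbedding : (c ⊗ 1)(x ⊗ 1) = c x ⊗ 1`) and `rationalToArchLocal … w : U(J)(F) →* U(σ_w J)(ℂ)`
  (`g ↦ σ_w(g)`), compatible with `archAt`;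
* when `c ≠ 1` fixes EVERY infinite place of `E` (so `E` is totally complex and every infinite place `v` of `F`
  has exactly one place `w` of `E` over it with `E_w = ℂ ⊋ F_v = ℝ` — the CM situation):
  `mem_arch_iff_forall` (membership in `U(J)(E ⊗ ℝ)` is checked place by place) and the factorisation
  **`UnitaryGroup.archPiEquiv : U(J)(E ⊗ ℝ) ≃ₜ* Π_w U(σ_w J)(ℂ)`** of topological groups, i.e.
  `U(J)(F ⊗_ℚ ℝ) = ∏_{v ∣ ∞} U(J)(F_v)`; each `archAt w` is surjective;
* transfer of REAL APPROXIMATION to a single place: IF `U(J)(F)` is dense in `U(J)(E ⊗ ℝ) = ∏_{v∣∞} U(J)(F_v)`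
  (weak approximation at the archimedean places for the connected group `U(J)` — Kneser; Platonov–Rapinchuk,
  *Algebraic Groups and Number Theory* (1994) Thm 7.7 p. 415; Sansuc, J. reine angew. Math. 327 (1981) Cor. 3.5;
  NOT proved here and NOT asserted: it enters only as the explicit hypothesis `hWA`), THEN `σ_{w₁}(U(J)(F))` is
  dense in the factor `U(σ_{w₁} J)(ℂ)` (`denseRange_rationalToArchLocal`) — the shape used for Picard modular
  surfaces (`U(2,1) × compact`);
* CM specialisations (`F = L⁺`, `E = L`, `c` = complex conjugation): `archPiEquivCM`, `denseRange_rationalToArchLocal_cm`.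

Everything here is proved (kernel); the only non-proved statement, weak approximation, is a named hypothesis of
the two transfer theorems, never a declaration. References for the objects: Platonov–Rapinchuk 1994 §2.3, §3.2,
§7.1; Borel–Jacquet 1979 §4.1.
-/

noncomputable section

open NumberField NumberField.InfinitePlace Topology

open scoped Matrix MatrixGroups ComplexConjugate ComplexOrder

namespace Literature.NumberTheory.Automorphic

namespace UnitaryGroup

open NumberField.mixedEmbedding

variable (F E : Type) [Field F] [NumberField F] [Field E] [NumberField E] [Algebra F E]
  (c : E ≃ₐ[F] E) (N : ℕ) (J : Matrix (Fin N) (Fin N) E)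

/-! ## 1. Rational points in `U(J)(E ⊗ ℝ)` -/

omit [NumberField F] [NumberField E] in
/-- `(c ⊗ 1)(x ⊗ 1) = (c x) ⊗ 1` on `E ⊗_ℚ ℝ`: the tree's `conjMixed` and Mathlib's `mixedEmbedding` commute with
`c` (transport of the tree's `InfiniteAdeleRing.smul_algebraMap`). [folklore] -/
theorem conjMixed_mixedEmbedding (x : E) : conjMixed F E c (mixedEmbedding E x) = mixedEmbedding E (c x) := by
  rw [InfiniteAdeleRing.mixedEmbedding_eq_algebraMap_comp, conjMixed_ringEquiv, InfiniteAdeleRing.smul_algebraMap,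
    ← InfiniteAdeleRing.mixedEmbedding_eq_algebraMap_comp]

/-- **The diagonal embedding `U(J)(F) →* U(J)(E ⊗ ℝ)`**, `g ↦ g ⊗ 1` (entrywise `mixedEmbedding`; the tree's
`unitaryGroupOfFormMap` along `conjMixed_mixedEmbedding`). Borel–Jacquet 1979, §4.1. [cite: BorelJacquet1979, §4.1] -/
def rationalToArch : rational F E c N J →* arch F E c N J :=
  unitaryGroupOfFormMap (σ := (c : E →+* E)) (τ := conjMixed F E c) (mixedEmbedding E)
    (fun x => (conjMixed_mixedEmbedding F E c x).symm) J

omit [NumberField F] [NumberField E] in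
/-- `rationalToArch g = GL_N(mixedEmbedding) g` on underlying invertible matrices. [folklore] -/
@[simp] theorem coe_rationalToArch (g : rational F E c N J) :
    ((rationalToArch F E c N J g : arch F E c N J) : GL (Fin N) (mixedSpace E)) =
      Matrix.GeneralLinearGroup.map (mixedEmbedding E) (g : GL (Fin N) E) :=
  rfl

omit [NumberField F] in
/-- The diagonal embedding `U(J)(F) → U(J)(E ⊗ ℝ)` is injective. [folklore] -/
theorem rationalToArch_injective : Function.Injective (rationalToArch F E c N J) := by
  intro g h hgh
  apply Subtype.ext
  apply Units.ext
  have h1 : (((g : rational F E c N J) : GL (Fin N) E) : Matrix (Fin N) (Fin N) E).map (mixedEmbedding E) =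
      (((h : rational F E c N J) : GL (Fin N) E) : Matrix (Fin N) (Fin N) E).map (mixedEmbedding E) :=
    congrArg (fun x : arch F E c N J => ((x : GL (Fin N) (mixedSpace E)) : Matrix (Fin N) (Fin N) (mixedSpace E))) hgh
  exact Matrix.ext fun i j => mixedEmbedding_injective E (congrFun (congrFun h1 i) j)

/-! ## 2. The local archimedean factor at a complex place -/

section Local

variable (w : {w : InfinitePlace E // IsComplex w})

/-- **`U(σ_w J)(ℂ) = {g ∈ GL_N(ℂ) ∣ ḡᵀ · σ_w(J) · g = σ_w(J)}`**, the unitary group of the matrix `σ_w(J)` —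
the archimedean local factor `U(J)(F_v)` at the place `v` of `F` under a complex place `w` of `E` fixed by `c`
(the tree's `unitaryGroupOfForm` over `ℂ` with `σ = conj`). Platonov–Rapinchuk 1994, §2.3.
[cite: PlatonovRapinchuk1994, §2.3] -/
def archLocal : Subgroup (GL (Fin N) ℂ) := unitaryGroupOfForm (starRingEnd ℂ) (J.map w.1.embedding)

omit [NumberField E] in
/-- Membership in `U(σ_w J)(ℂ)` (definitional). [folklore] -/
theorem mem_archLocal_iff (g : GL (Fin N) ℂ) :
    g ∈ archLocal E N J w ↔
      ((g : Matrix (Fin N) (Fin N) ℂ).map (starRingEnd ℂ))ᵀ * J.map w.1.embedding * (g : Matrix (Fin N) (Fin N) ℂ) =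
        J.map w.1.embedding :=
  Iff.rfl

omit [NumberField E] in
/-- Membership in `U(H)(ℂ)` via the conjugate transpose: `gᴴ H g = H`. [folklore] -/
theorem mem_archLocal_iff_conjTranspose (g : GL (Fin N) ℂ) :
    g ∈ archLocal E N J w ↔
      (g : Matrix (Fin N) (Fin N) ℂ)ᴴ * J.map w.1.embedding * (g : Matrix (Fin N) (Fin N) ℂ) = J.map w.1.embedding := by
  rw [mem_archLocal_iff, Matrix.conjTranspose, Matrix.transpose_map]
  rfl

omit [NumberField E] in
/-- `U(σ_w J)(ℂ)` is closed in `GL_N(ℂ)`. [folklore] -/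
theorem isClosed_archLocal : IsClosed (archLocal E N J w : Set (GL (Fin N) ℂ)) := by
  have h1 : Continuous fun g : GL (Fin N) ℂ => (g : Matrix (Fin N) (Fin N) ℂ) := Units.continuous_val
  exact isClosed_eq (((h1.matrix_map Complex.continuous_conj).matrix_transpose.mul continuous_const).mul h1)
    continuous_const

omit [NumberField E] in
/-- **`U(H)(ℂ)` is compact for a DEFINITE hermitian `H = ±σ_w(J)`**: entries of solutions of `gᴴ H g = H` are
bounded (`Matrix.exists_norm_entry_le_of_posDef`, U2-iii), so `U(H)(ℂ)` is a closed subset of a compact box under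
the closed embedding `GL_N ↪ M_N × M_Nᵐᵒᵖ`. (Platonov–Rapinchuk 1994, §3.2 Thm 3.1: anisotropic at `∞` ⇔ compact;
Knapp 2002, I.§1, `U(n)` compact.) [cite: PlatonovRapinchuk1994, §3.2 Thm 3.1] -/
theorem isCompact_archLocal_of_posDef
    (hdef : (J.map w.1.embedding).PosDef ∨ (-J.map w.1.embedding).PosDef) :
    IsCompact (archLocal E N J w : Set (GL (Fin N) ℂ)) := by
  classical
  set H : Matrix (Fin N) (Fin N) ℂ := J.map w.1.embedding with hHdef
  set S : Set (Matrix (Fin N) (Fin N) ℂ) := {M | Mᴴ * H * M = H} with hSdef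
  have hSclosed : IsClosed S :=
    isClosed_eq ((continuous_id.matrix_conjTranspose.mul continuous_const).mul continuous_id) continuous_const
  obtain ⟨C, hC⟩ : ∃ C : ℝ, ∀ M ∈ S, ∀ i j, ‖M i j‖ ≤ C := by
    rcases hdef with hpos | hneg
    · obtain ⟨C, hC⟩ := Matrix.exists_norm_entry_le_of_posDef hpos
      exact ⟨C, fun M hM i j => hC M hM i j⟩
    · obtain ⟨C, hC⟩ := Matrix.exists_norm_entry_le_of_posDef hneg
      refine ⟨C, fun M hM i j => hC M ?_ i j⟩
      have hM' : Mᴴ * H * M = H := hM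
      rw [Matrix.mul_neg, Matrix.neg_mul, hM']
  set box : Set (Matrix (Fin N) (Fin N) ℂ) := {M | ∀ i j, M i j ∈ Metric.closedBall (0 : ℂ) C} with hboxdef
  have hbox : IsCompact box := by
    have hb : box = Set.univ.pi fun _ : Fin N => Set.univ.pi fun _ : Fin N => Metric.closedBall (0 : ℂ) C :=
      Set.ext fun M => ⟨fun h i _ j _ => h i j, fun h i j => h i (Set.mem_univ _) j (Set.mem_univ _)⟩
    rw [hb]
    exact isCompact_univ_pi fun _ => isCompact_univ_pi fun _ => isCompact_closedBall _ _
  have hSsub : S ⊆ box := fun M hM i j => by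
    rw [Metric.mem_closedBall, dist_zero_right]; exact hC M hM i j
  have hScpt : IsCompact S := hbox.of_isClosed_subset hSclosed hSsub
  set T : Set (Matrix (Fin N) (Fin N) ℂ × (Matrix (Fin N) (Fin N) ℂ)ᵐᵒᵖ) :=
    {p | p.1 ∈ S ∧ p.2.unop ∈ S ∧ p.1 * p.2.unop = 1 ∧ p.2.unop * p.1 = 1} with hTdef
  have h1 : Continuous fun p : Matrix (Fin N) (Fin N) ℂ × (Matrix (Fin N) (Fin N) ℂ)ᵐᵒᵖ => p.1 := continuous_fst
  have h2 : Continuous fun p : Matrix (Fin N) (Fin N) ℂ × (Matrix (Fin N) (Fin N) ℂ)ᵐᵒᵖ => p.2.unop :=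
    MulOpposite.continuous_unop.comp continuous_snd
  have hTclosed : IsClosed T :=
    (hSclosed.preimage h1).inter ((hSclosed.preimage h2).inter
      ((isClosed_eq (h1.mul h2) continuous_const).inter (isClosed_eq (h2.mul h1) continuous_const)))
  have hTsub : T ⊆ S ×ˢ (MulOpposite.op '' S) := by
    rintro ⟨a, b⟩ ⟨ha, hb, -, -⟩
    exact ⟨ha, b.unop, hb, rfl⟩
  have hTcpt : IsCompact T :=
    (hScpt.prod (hScpt.image MulOpposite.continuous_op)).of_isClosed_subset hTclosed hTsub
  have hmemS : ∀ g : GL (Fin N) ℂ, g ∈ archLocal E N J w ↔ (g : Matrix (Fin N) (Fin N) ℂ) ∈ S := fun g =>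
    mem_archLocal_iff_conjTranspose E N J w g
  have himage : Units.embedProduct (Matrix (Fin N) (Fin N) ℂ) '' (archLocal E N J w : Set (GL (Fin N) ℂ)) = T := by
    ext p
    constructor
    · rintro ⟨g, hg, rfl⟩
      exact ⟨(hmemS g).1 hg, (hmemS g⁻¹).1 ((archLocal E N J w).inv_mem hg), g.mul_inv, g.inv_mul⟩
    · rintro ⟨hp1, -, hp3, hp4⟩
      exact ⟨⟨p.1, p.2.unop, hp3, hp4⟩, (hmemS _).2 hp1, Prod.ext rfl rfl⟩
  rw [Units.isEmbedding_embedProduct.isCompact_iff, himage]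
  exact hTcpt

omit [NumberField F] [NumberField E] in
/-- At a complex place fixed by `c ≠ 1`, **`σ_w ∘ c = conj ∘ σ_w`** (tree `conjCoord_embedding` +
`conjCoord_eq_conj`). [folklore] -/
theorem embedding_galConj (hw : c • w.1 = w.1) (hc : c ≠ 1) (x : E) :
    w.1.embedding (c x) = starRingEnd ℂ (w.1.embedding x) := by
  have h := conjCoord_embedding F E c w x
  rw [conjCoord_eq_conj F E c hw hc, congrArg InfinitePlace.embedding hw] at h
  exact h.symm

/-- **The embedding `U(J)(F) →* U(σ_w J)(ℂ)`, `g ↦ σ_w(g)`** at a complex place `w` fixed by `c ≠ 1`.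
[cite: BorelJacquet1979, §4.1] -/
def rationalToArchLocal (hw : c • w.1 = w.1) (hc : c ≠ 1) : rational F E c N J →* archLocal E N J w :=
  unitaryGroupOfFormMap (σ := (c : E →+* E)) (τ := starRingEnd ℂ) w.1.embedding
    (fun x => embedding_galConj F E c w hw hc x) J

omit [NumberField F] [NumberField E] in
/-- `rationalToArchLocal w g = GL_N(σ_w) g` on underlying invertible matrices. [folklore] -/
@[simp] theorem coe_rationalToArchLocal (hw : c • w.1 = w.1) (hc : c ≠ 1) (g : rational F E c N J) :
    ((rationalToArchLocal F E c N J w hw hc g : archLocal E N J w) : GL (Fin N) ℂ) =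
      Matrix.GeneralLinearGroup.map (w.1.embedding) (g : GL (Fin N) E) :=
  rfl

omit [NumberField F] [NumberField E] in
/-- `evalC w` is continuous. [folklore] -/
theorem continuous_evalC : Continuous (evalC E w) := (continuous_apply w).comp continuous_snd

/-- **The `w`-component `U(J)(E ⊗ ℝ) →* U(σ_w J)(ℂ)`** at a complex place `w` fixed by `c ≠ 1` (restriction of
`GL_N(evalC w)`; membership by the tree's `map_mem_unitaryGroupOfForm` along `evalC_conjMixed`,
`archFormOf_map_evalC`). [cite: BorelJacquet1979, §4.1] -/
def archAt (hw : c • w.1 = w.1) (hc : c ≠ 1) : arch F E c N J →* archLocal E N J w :=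
  (((Matrix.GeneralLinearGroup.map (evalC E w)).restrict (arch F E c N J))).codRestrict (archLocal E N J w)
    fun g => by
      have h := map_mem_unitaryGroupOfForm (σ := conjMixed F E c) (τ := starRingEnd ℂ) (evalC E w)
        (evalC_conjMixed F E c hw hc) g.2
      rw [archFormOf_map_evalC] at h
      exact h

omit [NumberField F] [NumberField E] in
/-- `archAt w g = GL_N(evalC w) g` on underlying invertible matrices. [folklore] -/
@[simp] theorem coe_archAt (hw : c • w.1 = w.1) (hc : c ≠ 1) (g : arch F E c N J) :
    ((archAt F E c N J w hw hc g : archLocal E N J w) : GL (Fin N) ℂ) =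
      Matrix.GeneralLinearGroup.map (evalC E w) (g : GL (Fin N) (mixedSpace E)) :=
  rfl

omit [NumberField F] [NumberField E] in
/-- Entries of `archAt w g`: the `w`-coordinates of the entries of `g`. [folklore] -/
theorem coe_archAt_apply (hw : c • w.1 = w.1) (hc : c ≠ 1) (g : arch F E c N J) (i j : Fin N) :
    (((archAt F E c N J w hw hc g : archLocal E N J w) : GL (Fin N) ℂ) : Matrix (Fin N) (Fin N) ℂ) i j =
      (((g : GL (Fin N) (mixedSpace E)) : Matrix (Fin N) (Fin N) (mixedSpace E)) i j).2 w :=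
  rfl

omit [NumberField F] [NumberField E] in
/-- `archAt w` is continuous. [folklore] -/
theorem continuous_archAt (hw : c • w.1 = w.1) (hc : c ≠ 1) : Continuous (archAt F E c N J w hw hc) :=
  (((continuous_evalC E w).generalLinearGroup_map :
      Continuous (Matrix.GeneralLinearGroup.map (n := Fin N) (evalC E w))).comp continuous_subtype_val).subtype_mk _

omit [NumberField F] [NumberField E] in
/-- **Compatibility `(g ⊗ 1)_w = σ_w(g)`**: the `w`-component of a rational point is its image under `σ_w`
(Mathlib `mixedEmbedding_apply_isComplex`). [folklore] -/
theorem archAt_rationalToArch (hw : c • w.1 = w.1) (hc : c ≠ 1) (g : rational F E c N J) :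
    archAt F E c N J w hw hc (rationalToArch F E c N J g) = rationalToArchLocal F E c N J w hw hc g :=
  Subtype.ext <| Units.ext <| Matrix.ext fun _ _ => mixedEmbedding_apply_isComplex E _ w

end Local

/-! ## 3. All infinite places fixed by `c ≠ 1`: `U(J)(E ⊗ ℝ) ≃ₜ* Π_w U(σ_w J)(ℂ)` -/

section AllFixed

variable (hc : c ≠ 1) (hfix : ∀ w : InfinitePlace E, c • w = w)

omit [NumberField F] [NumberField E] in
include hc hfix in
/-- If `c ≠ 1` fixes every infinite place then `E` has no real place (U2-iii `isComplex_of_smul_eq`). [folklore] -/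
theorem isEmpty_isReal : IsEmpty {w : InfinitePlace E // IsReal w} :=
  ⟨fun w => not_isReal_iff_isComplex.mpr (isComplex_of_smul_eq F E c hc (hfix w.1)) w.2⟩

omit [NumberField F] [NumberField E] in
include hc hfix in
/-- With no real places, an element of `E ⊗ ℝ = ℝ^{r₁} × ℂ^{r₂}` is determined by its complex coordinates.
[folklore] -/
theorem mixedSpace_ext {x y : mixedSpace E} (h : ∀ w : {w : InfinitePlace E // IsComplex w}, x.2 w = y.2 w) :
    x = y :=
  haveI := isEmpty_isReal F E c hc hfix
  Prod.ext (funext fun w => isEmptyElim w) (funext h)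

omit [NumberField F] [NumberField E] in
include hc hfix in
/-- **Membership in `U(J)(E ⊗ ℝ)` is checked place by place**: `g ∈ U(J)(E ⊗ ℝ)` iff `g_w ∈ U(σ_w J)(ℂ)` for
every (complex) place `w` — when `c ≠ 1` fixes all infinite places. [folklore] -/
theorem mem_arch_iff_forall (g : GL (Fin N) (mixedSpace E)) :
    g ∈ arch F E c N J ↔ ∀ w : {w : InfinitePlace E // IsComplex w},
      Matrix.GeneralLinearGroup.map (evalC E w) g ∈ archLocal E N J w := by
  constructor
  · intro hg w
    exact (archAt F E c N J w (hfix w.1) hc ⟨g, hg⟩).2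
  · intro h
    rw [mem_arch_iff]
    refine Matrix.ext fun i j => mixedSpace_ext F E c hc hfix fun w => ?_
    have hw := h w
    rw [mem_archLocal_iff] at hw
    have hfun : (⇑(evalC E w) ∘ ⇑(conjMixed F E c)) = (⇑(starRingEnd ℂ) ∘ ⇑(evalC E w)) :=
      funext fun x => evalC_conjMixed F E c (hfix w.1) hc x
    have hval : ((Matrix.GeneralLinearGroup.map (evalC E w) g : GL (Fin N) ℂ) : Matrix (Fin N) (Fin N) ℂ) =
        ((g : Matrix (Fin N) (Fin N) (mixedSpace E))).map (evalC E w) := rfl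
    rw [hval, Matrix.map_map, ← hfun, ← Matrix.map_map, ← archFormOf_map_evalC E N J w,
      ← Matrix.transpose_map, ← Matrix.map_mul, ← Matrix.map_mul] at hw
    exact (congrFun (congrFun hw i) j : _)

/-- With no real places, `E ⊗ ℝ ≃+* ℂ^{r₂}` (drop the empty real factor). [folklore] -/
def mixedSpaceRingEquivPi : mixedSpace E ≃+* ({w : InfinitePlace E // IsComplex w} → ℂ) where
  toFun x := x.2
  invFun y := (0, y)
  left_inv _ := mixedSpace_ext F E c hc hfix fun _ => rfl
  right_inv _ := rfl
  map_mul' _ _ := rfl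
  map_add' _ _ := rfl

omit [NumberField F] [NumberField E] in
/-- `mixedSpaceRingEquivPi x = x.2`. [folklore] -/
@[simp] theorem mixedSpaceRingEquivPi_apply (x : mixedSpace E) : mixedSpaceRingEquivPi F E c hc hfix x = x.2 := rfl

omit [NumberField F] [NumberField E] in
/-- `mixedSpaceRingEquivPi.symm y = (0, y)`. [folklore] -/
@[simp] theorem mixedSpaceRingEquivPi_symm_apply (y : {w : InfinitePlace E // IsComplex w} → ℂ) :
    (mixedSpaceRingEquivPi F E c hc hfix).symm y = (0, y) := rfl

/-- `M_N(E ⊗ ℝ) ≃ₜ* M_N(ℂ^{r₂})` (entrywise `mixedSpaceRingEquivPi`; a homeomorphism). [folklore] -/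
def matrixMixedEquiv :
    Matrix (Fin N) (Fin N) (mixedSpace E) ≃ₜ* Matrix (Fin N) (Fin N) ({w : InfinitePlace E // IsComplex w} → ℂ) :=
  { (mixedSpaceRingEquivPi F E c hc hfix).mapMatrix.toMulEquiv with
    continuous_toFun := continuous_id.matrix_map continuous_snd
    continuous_invFun := continuous_id.matrix_map (continuous_const.prodMk continuous_id) }

/-- **`GL_N(E ⊗ ℝ) ≃ₜ* Π_w GL_N(ℂ)`** over the complex places, when `E` has no real place (U2-i `GLn.piEquiv`
after `matrixMixedEquiv`). [folklore] -/
def GLnMixedPiEquiv : GL (Fin N) (mixedSpace E) ≃ₜ* ({w : InfinitePlace E // IsComplex w} → GL (Fin N) ℂ) :=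
  (Units.mapContinuousMulEquiv (matrixMixedEquiv F E c N hc hfix)).trans (GLn.piEquiv (fun _ => ℂ) (Fin N))

omit [NumberField F] [NumberField E] in
/-- Components of `GLnMixedPiEquiv g` are the `GL_N(evalC w) g`. [folklore] -/
@[simp] theorem GLnMixedPiEquiv_apply (g : GL (Fin N) (mixedSpace E)) (w : {w : InfinitePlace E // IsComplex w}) :
    GLnMixedPiEquiv F E c N hc hfix g w = Matrix.GeneralLinearGroup.map (evalC E w) g :=
  Units.ext rfl

omit [NumberField F] [NumberField E] in
/-- Entries of `GLnMixedPiEquiv.symm u`: complex coordinates `(u w)_{ij}`, real coordinates none. [folklore] -/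
theorem coe_GLnMixedPiEquiv_symm_apply (u : {w : InfinitePlace E // IsComplex w} → GL (Fin N) ℂ) (i j : Fin N)
    (w : {w : InfinitePlace E // IsComplex w}) :
    ((((GLnMixedPiEquiv F E c N hc hfix).symm u : GL (Fin N) (mixedSpace E)) : Matrix (Fin N) (Fin N) (mixedSpace E))
      i j).2 w = ((u w : GL (Fin N) ℂ) : Matrix (Fin N) (Fin N) ℂ) i j :=
  rfl

omit [NumberField F] [NumberField E] in
/-- `GL_N(evalC w)` of `GLnMixedPiEquiv.symm u` is `u w`. [folklore] -/
@[simp] theorem map_evalC_GLnMixedPiEquiv_symm (u : {w : InfinitePlace E // IsComplex w} → GL (Fin N) ℂ)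
    (w : {w : InfinitePlace E // IsComplex w}) :
    Matrix.GeneralLinearGroup.map (evalC E w) ((GLnMixedPiEquiv F E c N hc hfix).symm u) = u w := by
  rw [← GLnMixedPiEquiv_apply F E c N hc hfix, ContinuousMulEquiv.apply_symm_apply]

/-- **`U(J)(E ⊗_ℚ ℝ) ≃ₜ* Π_w U(σ_w J)(ℂ)` as topological groups** — the factorisation
`U(J)(F ⊗_ℚ ℝ) = ∏_{v ∣ ∞} U(J)(F_v)` of the archimedean group into its local factors, for `c ≠ 1` fixing every
infinite place of `E` (restriction of `GLnMixedPiEquiv` along `mem_arch_iff_forall`). Platonov–Rapinchuk 1994,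
§2.3 / §7.1; Borel–Jacquet 1979 §4.1. [cite: BorelJacquet1979, §4.1] -/
def archPiEquiv : arch F E c N J ≃ₜ* (∀ w : {w : InfinitePlace E // IsComplex w}, archLocal E N J w) where
  toFun g := fun w => archAt F E c N J w (hfix w.1) hc g
  invFun u := ⟨(GLnMixedPiEquiv F E c N hc hfix).symm (fun w => (u w : GL (Fin N) ℂ)),
    (mem_arch_iff_forall F E c N J hc hfix _).2 fun w => by
      rw [map_evalC_GLnMixedPiEquiv_symm]; exact (u w).2⟩
  left_inv g := by
    apply Subtype.ext
    change (GLnMixedPiEquiv F E c N hc hfix).symm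
      (fun w => Matrix.GeneralLinearGroup.map (evalC E w) (g : GL (Fin N) (mixedSpace E))) = _
    have h : (fun w => Matrix.GeneralLinearGroup.map (evalC E w) (g : GL (Fin N) (mixedSpace E))) =
        GLnMixedPiEquiv F E c N hc hfix (g : GL (Fin N) (mixedSpace E)) :=
      funext fun w => (GLnMixedPiEquiv_apply F E c N hc hfix _ w).symm
    rw [h, ContinuousMulEquiv.symm_apply_apply]
  right_inv u := funext fun w => Subtype.ext (by
    change Matrix.GeneralLinearGroup.map (evalC E w)
      ((GLnMixedPiEquiv F E c N hc hfix).symm fun w => (u w : GL (Fin N) ℂ)) = _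
    rw [map_evalC_GLnMixedPiEquiv_symm])
  map_mul' g h := funext fun w => map_mul (archAt F E c N J w (hfix w.1) hc) g h
  continuous_toFun := continuous_pi fun w => continuous_archAt F E c N J w (hfix w.1) hc
  continuous_invFun :=
    ((GLnMixedPiEquiv F E c N hc hfix).symm.continuous.comp
      (continuous_pi fun w => continuous_subtype_val.comp (continuous_apply w))).subtype_mk _

omit [NumberField F] [NumberField E] in
/-- `archPiEquiv g w = archAt w g = g_w`. [folklore] -/
@[simp] theorem archPiEquiv_apply (g : arch F E c N J) (w : {w : InfinitePlace E // IsComplex w}) :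
    archPiEquiv F E c N J hc hfix g w = archAt F E c N J w (hfix w.1) hc g := rfl

omit [NumberField F] [NumberField E] in
/-- `archPiEquiv.symm u` has `w`-component `u w`. [folklore] -/
@[simp] theorem archAt_archPiEquiv_symm (u : ∀ w : {w : InfinitePlace E // IsComplex w}, archLocal E N J w)
    (w : {w : InfinitePlace E // IsComplex w}) :
    archAt F E c N J w (hfix w.1) hc ((archPiEquiv F E c N J hc hfix).symm u) = u w := by
  rw [← archPiEquiv_apply F E c N J hc hfix, ContinuousMulEquiv.apply_symm_apply]

omit [NumberField F] [NumberField E] in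
/-- On underlying matrices: `archPiEquiv.symm u` has complex coordinates `(u w)_{ij}`. [folklore] -/
theorem coe_archPiEquiv_symm_apply (u : ∀ w : {w : InfinitePlace E // IsComplex w}, archLocal E N J w)
    (i j : Fin N) (w : {w : InfinitePlace E // IsComplex w}) :
    (((((archPiEquiv F E c N J hc hfix).symm u : arch F E c N J) : GL (Fin N) (mixedSpace E)) :
        Matrix (Fin N) (Fin N) (mixedSpace E)) i j).2 w = (((u w : archLocal E N J w) : GL (Fin N) ℂ) :
          Matrix (Fin N) (Fin N) ℂ) i j :=
  rfl

omit [NumberField F] [NumberField E] in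
include hfix hc in
/-- **Each component `U(J)(E ⊗ ℝ) →* U(σ_w J)(ℂ)` is surjective** (when `c ≠ 1` fixes every infinite place).
[folklore] -/
theorem archAt_surjective (w : {w : InfinitePlace E // IsComplex w}) :
    Function.Surjective (archAt F E c N J w (hfix w.1) hc) := fun u => by
  classical
  exact ⟨(archPiEquiv F E c N J hc hfix).symm (Pi.mulSingle w u), by
    rw [archAt_archPiEquiv_symm, Pi.mulSingle_eq_same]⟩

omit [NumberField F] [NumberField E] in
include hfix hc in
/-- **Transfer of real approximation to one place.** IF `U(J)(F)` is dense in
`U(J)(E ⊗ ℝ) = ∏_{v ∣ ∞} U(J)(F_v)` — weak approximation at the archimedean places for the connected reductive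
group `U(J)` (Kneser; Platonov–Rapinchuk 1994 Thm 7.7 p. 415: "a connected group over a number field has weak
approximation with respect to the archimedean places"; Sansuc 1981 Cor. 3.5), which is NOT proved here and enters
ONLY as the hypothesis `hWA` — THEN the image `σ_{w}(U(J)(F))` is dense in the factor `U(σ_w J)(ℂ)` (a dense
subset maps onto a dense subset under the continuous surjection `archAt w`). For a hermitian space of signature
`(2,1)` at `w₁` and definite elsewhere this is "`U(J)(F)` is dense in `U(2,1)`" (Picard modular surfaces). [folklore] -/
theorem denseRange_rationalToArchLocal (hWA : DenseRange (rationalToArch F E c N J))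
    (w : {w : InfinitePlace E // IsComplex w}) :
    DenseRange (rationalToArchLocal F E c N J w (hfix w.1) hc) := by
  have h : (rationalToArchLocal F E c N J w (hfix w.1) hc : rational F E c N J → archLocal E N J w) =
      archAt F E c N J w (hfix w.1) hc ∘ rationalToArch F E c N J :=
    funext fun g => (archAt_rationalToArch F E c N J w (hfix w.1) hc g).symm
  rw [h]
  exact (archAt_surjective F E c N J hc hfix w).denseRange.comp hWA (continuous_archAt F E c N J w (hfix w.1) hc)

end AllFixed

/-! ## 4. The CM case -/

section CM

variable (L : Type) [Field L] [NumberField L] [IsCMField L] (H : Matrix (Fin N) (Fin N) L)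

/-- **CM case: `U(H)(L ⊗ ℝ) ≃ₜ* Π_w U(σ_w H)(ℂ)`** over the complex places `w` of the CM field `L`
(`F = L⁺`, `c` = complex conjugation, which is `≠ 1` and fixes every infinite place — U2-iii
`complexConj_smul_infinitePlace`). [folklore] -/
def archPiEquivCM :
    arch (↥(maximalRealSubfield L)) L (IsCMField.complexConj L) N H ≃ₜ*
      (∀ w : {w : InfinitePlace L // IsComplex w}, archLocal L N H w) :=
  archPiEquiv _ L (IsCMField.complexConj L) N H (IsCMField.complexConj_ne_one L)
    (complexConj_smul_infinitePlace L)

/-- **CM case, transfer of real approximation**: if `U(H)(L⁺)` is dense in `U(H)(L ⊗ ℝ)` (weak approximation,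
hypothesis `hWA`), then `σ_w(U(H)(L⁺))` is dense in `U(σ_w H)(ℂ)` for every complex place `w` — e.g. in the
`U(2,1)` factor of a Picard datum. [folklore] -/
theorem denseRange_rationalToArchLocal_cm
    (hWA : DenseRange (rationalToArch (↥(maximalRealSubfield L)) L (IsCMField.complexConj L) N H))
    (w : {w : InfinitePlace L // IsComplex w}) :
    DenseRange (rationalToArchLocal (↥(maximalRealSubfield L)) L (IsCMField.complexConj L) N H w
      (complexConj_smul_infinitePlace L w.1) (IsCMField.complexConj_ne_one L)) :=
  denseRange_rationalToArchLocal _ L _ N H (IsCMField.complexConj_ne_one L) (complexConj_smul_infinitePlace L) hWA w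

end CM

end UnitaryGroup

end Literature.NumberTheory.Automorphic

end
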